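import Summits.HodgeConjecture.HodgeConjecture.Theorems.TropicalWeilObstructionTropicalWeilVanishingCalibrationTwoSeedDataB
import Summits.HodgeConjecture.HodgeConjecture.Theorems.TropicalWeilObstructionTropicalWeilVanishingCalibrationTwoSeedDataC

/-!
# Route `TropicalWeilObstruction` (Kontsevich's tropical test — NEGATION SINK, exploration, no summit claim):
# the `n = 2` CALIBRATION seed — KERNEL CHECKS part A: the cells (edge equations, orientation, saturation, facet identities)

Negation-sink bookkeeping of the cell `pub-hodge-tropical` (seat tropical-2 gen 7). Every identity the tree's certificate format
`TropicalTorusCycle 4 2 Q` asks of the `240`-cell seed of `…CalibrationTwoSeedData{A–G}` (tropicalised van Geemen exceptional cycle on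
the tropical Weil fourfold of period `Q = QZ/2`), and the four integer solutions of its linearised realisation system (p313252), as
closed integer statements proved by `decide +kernel`: edge equations (`vert_id`), positive edge determinants (`det_pos`), saturation
(`leftinv`), the facet identities at period `QZ` (`facet_id`), the slot lists of the facet classes (`slots_mem`, `slots_cls`,
`slots_nodup`), the balancing of every facet class on all Plücker coordinates in reduced form (`balanced_red`), the value
`Σ_σ w_σ det(Tz_σ)((Re η_σ)² − (Im η_σ)²) = reW2 ≠ 0` (`reW2_sum`, `reW2_ne_zero`), and the section identities in the four directions `E2 t`
(`sec_vert`, `sec_facet`). The assembly into a `TropicalTorusCycle`, `W ≠ 0` and the calibration theorem are in `…CalibrationTwo`.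

HONEST STATUS. Kernel re-check of a seat computation (independent replication of ring-2 seat b04 g37's n = 2 calibration); decides
nothing about K1 (`TropicalWeilVanishing`, `n = 4`, OPEN) or about HC. No named fact, no sorry; `decide +kernel` on integer literals only.
References: [Zharkov2020TropicalWeil] I. Zharkov, arXiv:2002.02347, §2 (pp. 2–4); [MikhalkinZharkov2014Eigenwave] G. Mikhalkin,
I. Zharkov, LN UMI 15 (2014), Def. 4.2, Prop. 4.3; B. van Geemen, CIME lecture (LNM 1594, 1994) §7.5.
-/

set_option linter.dupNamespace false

namespace Summit.HodgeConjecture.HodgeConjecture.Theorems.TropicalWeilVanishing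

namespace CalibTwo

open scoped BigOperators

set_option maxRecDepth 100000 in
set_option maxHeartbeats 400000000 in
/-- Positivity of the weights. [folklore] -/
theorem wt_pos : ∀ σ : Fin N, 0 < wt σ := by
  intro σ; fin_cases σ <;> decide +kernel

/-! ### The cells -/

set_option maxRecDepth 100000 in
set_option maxHeartbeats 400000000 in
/-- Edge equations: `Vz σ (j+1) − Vz σ 0 = Fz σ · Tz σ e_j` for all `240` cells. [folklore] -/
theorem vert_id : ∀ (σ : Fin N) (j : Fin 2) (a : Fin 4),
    Vz σ j.succ a - Vz σ 0 a = ∑ m : Fin 2, Fz σ a m * Tz σ m j := by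
  intro σ; fin_cases σ <;> decide +kernel

set_option maxRecDepth 100000 in
set_option maxHeartbeats 400000000 in
/-- Positive orientation: `det Tz σ > 0` (written out for `2 × 2`). [folklore] -/
theorem det_pos : ∀ σ : Fin N, 0 < Tz σ 0 0 * Tz σ 1 1 - Tz σ 0 1 * Tz σ 1 0 := by
  intro σ; fin_cases σ <;> decide +kernel

set_option maxRecDepth 100000 in
set_option maxHeartbeats 400000000 in
/-- Saturation: `Mz σ * Fz σ = 1` for all cells. [folklore] -/
theorem leftinv : ∀ σ : Fin N, Mz σ * Fz σ = 1 := by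
  intro σ; fin_cases σ <;> decide +kernel

/-- The facet re-ordering of slot `(σ, i)`: the transposition of `Fin 2` if `swp σ i`, else the identity. [folklore] -/
def prm (σ : Fin N) (i : Fin 3) : Equiv.Perm (Fin 2) := if swp σ i then Equiv.swap 0 1 else 1

/-- Its sign as an integer: `−1` if `swp σ i`, else `1`. [folklore] -/
def sgn (σ : Fin N) (i : Fin 3) : ℤ := if swp σ i then -1 else 1

/-- `sign (prm σ i) = sgn σ i`. [folklore] -/
theorem sign_prm (σ : Fin N) (i : Fin 3) : ((Equiv.Perm.sign (prm σ i) : ℤˣ) : ℤ) = sgn σ i := by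
  unfold prm sgn
  split_ifs with h
  · rw [Equiv.Perm.sign_swap (by decide)]; rfl
  · simp

set_option maxRecDepth 100000 in
set_option maxHeartbeats 400000000 in
/-- Facet identities at the doubled period: vertex `i.succAbove (prm σ i j)` of cell `σ` is vertex `j` of the reference facet of its
class translated by `QZ · Sz σ i`. [folklore] -/
theorem facet_id : ∀ (σ : Fin N) (i : Fin 3) (j : Fin 2) (a : Fin 4),
    Vz σ (i.succAbove (prm σ i j)) a = Rz (cls σ i) j a + ∑ b : Fin 4, QZ a b * Sz σ i b := by
  intro σ; fin_cases σ <;> decide +kernel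

end CalibTwo

end Summit.HodgeConjecture.HodgeConjecture.Theorems.TropicalWeilVanishing
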